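import Literature.IUT.HodgeTheaters.GenuineFKitOfBadLocalNVSlots
import Literature.IUT.HodgeTheaters.InitialThetaDataLocalDeltaCharacteristic
import HarnessLib

/-!
# [IUTchI] Example 3.2 (vi)(a)(b)(c) AT THE STAND-IN MERGE RECORD with the last anabelian binder `hΔ` DERIVED —
# «`Δ_v̲ ⊆ Π_v̲` is characteristic» ([AbsAnab] Lemma 1.3.8, FACT F-0007 shape) at `m2StandIn` from F-0240 + F-0001 (proofs only)

S. Mochizuki, *Inter-universal Teichmüller theory I*, kurims manuscript (May 2020), Example 3.2 (vi) p. 73 («(a) … a functorial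
algorithm for reconstructing the subcategory `𝒟⊢_v ⊆ 𝒟_v` from the category `𝒟_v` [cf. [AbsAnab], Lemma 1.3.8]; (b) … the category
`𝒟^Θ_v` from the category `𝒟_v`; (c) … `𝒟⊢_v` (respectively, `𝒟^Θ_v`) from `𝒞⊢_v` (respectively, `𝒞^Θ_v`)»), Definition 3.1 (e)(f)
pp. 62–63 ([IUTchI] Ex 3.2 (vi) p.73) [claim: Mochizuki2012, status: disputed] (D-0012 claim key, series status DISPUTED — compositions BY
NAME over landed files; nothing of the series is asserted; no side is taken on [IUTchIII] Cor. 3.12); S. Mochizuki, *The Absolute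
Anabelian Geometry of Hyperbolic Curves* (2004) [AbsAnab], Lemma 1.3.8 p. 18 («compatible with the quotients `Π ↠ G_K`»; proof p. 19:
«follows formally from Lemmas 1.1.4, 1.1.5») [cite: MochizukiAbsAnab2004, Lemma 1.3.8 p.18]; *Topics in Absolute Anabelian Geometry I*
(2012) [AbsTopI], Thm 2.6 (v) p. 22 («the kernel of `Π ↠ G` may be characterized group-theoretically») [cite: MochizukiAbsTopI2012, Thm 2.6 (v) p.22].

PURPOSE (abc-iut-L5-lead RULINGS #123 (3): TOKEN EDIT v2.10 census of [IUTchI] Ex. 3.2 per sub-item at the merge, «each binder shown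
FACT-by-name / ORIGIN / discharged»).  At the explicit R59 stand-in datum — `B := badPairAtArrow hA`, (m2) `m2StandIn hA CG hTFG x hx`
(abc-iut-L5-t2 ★ p499559: `Π_v̲ = Π_{X̲→_K} ∩ augGF⁻¹ G_v̲ ⊆ Π_{C_F}` with GENUINE augmentation `augLoc ∘ standInEquiv⁻¹` onto
`Gal(K̄_v̲/K_v̲)`), record `mergeInputsStandIn` (★ p501395 / abc-iut-w4-d077 ★ p500756) — the closer `ex32vi_abc_frobeniusBadAt_standIn`
(★ p501395) displays ONE anabelian binder, in unfolded F-0007 shape: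
`hΔ : ∀ φ : Π_v̲ ≃ₜ* Π_v̲, Ker((m2StandIn).aug).map φ = Ker((m2StandIn).aug)`.
THIS PROOF-ONLY FILE (no `def`, no `instance`, no named fact) DERIVES `hΔ` at the stand-in by TRANSPORT along the bicontinuous
identification `standInEquiv : Π_{X̲→_K} ×_{G_K} Gal(K̄_v̲/K_v̲) ≃ₜ* Π_v̲` of abc-iut-L5-t16's `InitialThetaDataLocalDeltaCharacteristic.lean`
(the currency of record for [IUTchI] Ex. 3.3 (iii)(a), `ddashFromD_goodLocalFrobenioidAt_of_coinvariantRank`):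
* `mem_ker_m2StandIn_aug_iff` / `ker_m2StandIn_aug_eq_map` — `Ker((m2StandIn).aug) = Ker(augLoc).map standInEquiv`;
* (private) `subgroup_map_equiv_transport` — pure group theory: a subgroup invariant under every bicontinuous automorphism stays so after
  transport along a bicontinuous isomorphism;
* `forall_map_ker_m2StandIn_aug_of_forall_map_ker_augLoc` — `hΔ` at `Π_v̲` from `hΔ` at `Π_{X̲→_K} ×_{G_K} Gal(K̄_v̲/K_v̲)`;
* `forall_map_ker_m2StandIn_aug_of_preservesGeom` — F-0007 `PreservesGeom` BY NAME on ANY packaging `Ev` of `Π_v̲ ↠ Gal(K̄_v̲/K_v̲)` as an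
  abc-iut-L4 `FundamentalExtension`; `exists_fundamentalExtension_standIn` — NON-VACUITY of that packaging WITH MLF base data
  (`K := K_v̲ = RescaledCompletion K p_v̲ w_v̲`, `galIso = id`), `Δ` tfg under F-0240;
* `forall_map_ker_m2StandIn_aug_of_regime` — F-0001 `CoinvariantRankConstant` BY NAME on every such packaging ([AbsTopI] Thm 2.6 (v),
  kernel theorem `preservesGeom_of_coinvariantRankConstant`);
* `forall_map_ker_m2StandIn_aug_of_coinvariantRank` — F-0001 in UNFOLDED shape at `Π_{X̲→_K} ×_{G_K} Gal(K̄_v̲/K_v̲)` (the `rfl`-same binder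
  type as Ex. 3.3 (iii)(a)'s at `(p_v̲, w_v̲)`), with `hX` FREE here (`isOpen_PiXarrow_of_cuspGalois hA hTFG CG`) and F-0240 = the record's `hTFG`;
* cone read-outs `ex32vi_abc_frobeniusBadAt_standIn_of_coinvariantRank` / `_of_regime` / `_of_preservesGeom`:
  **(a) ∧ (b) ∧ (c) at `frobeniusBadAt (badPairAtArrow hA) (mergeInputsStandIn …) x hx`** with binder census
  {`D`, `hA`, `CG`, `hTFG` (F-0240 by name), `x`, `hx`, F-0001 shape at `Π_{X̲→_K} ×_{G_K} Gal(K̄_v̲/K_v̲)` | F-0001 / F-0007 BY NAME on packagings} —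
  `hH`, `hY` (★ p501395) and now `hΔ` all gone.
LABEL «[MODEL datum: m2 aug genuine / `Ÿ` degenerate; m1 formal; m4 genuine]»; a regime instance of OUR predicate at OUR object, not
print's Lemma 1.3.8; [AbsAnab]/[AbsTopI] are refereed and undisputed; no Ex. 3.2 (i) token; no instance, no notation, no `sorry`;
typed ≠ inhabited ≠ proved; nothing here asserts abc proved or refuted.
-/

noncomputable section

namespace Literature.IUT.HodgeTheaters

open Literature.AnabelianGeometry.AbsoluteAnabelian Literature.AlgebraicGeometry.Frobenioids.PadicFrd Literature.NumberTheory.NumberFields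
  _root_.IsDedekindDomain Topology

/-! ### Pure group theory: invariance under all bicontinuous automorphisms transports along a bicontinuous isomorphism -/

/-- **Transport of characteristic subgroups**: if `N ⊆ A` is carried onto itself by every bicontinuous automorphism of `A` and
`e : A ≃ₜ* B`, then `e(N) ⊆ B` is carried onto itself by every bicontinuous automorphism `φ` of `B` (conjugate `φ` back to
`e⁻¹ ∘ φ ∘ e`). [folklore] -/
private theorem subgroup_map_equiv_transport {A B : Type*} [Group A] [Group B] [TopologicalSpace A] [TopologicalSpace B]
    (e : A ≃ₜ* B) (N : Subgroup A) (hN : ∀ ψ : A ≃ₜ* A, N.map ψ.toMulEquiv.toMonoidHom = N) (φ : B ≃ₜ* B) :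
    (N.map e.toMulEquiv.toMonoidHom).map φ.toMulEquiv.toMonoidHom = N.map e.toMulEquiv.toMonoidHom := by
  have h := hN (e.trans (φ.trans e.symm))
  apply_fun Subgroup.map e.toMulEquiv.toMonoidHom at h
  rw [Subgroup.map_map] at h
  rw [Subgroup.map_map]
  convert h using 2
  refine MonoidHom.ext fun a => ?_
  change φ (e a) = e ((e.trans (φ.trans e.symm)) a)
  simp

variable {F K Fbar : Type} [Field F] [NumberField F] [Field K] [NumberField K] [Algebra F K]
  [Field Fbar] [Algebra F Fbar] [Algebra K Fbar] {E : WeierstrassCurve F}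
  [E.IsElliptic] {l : ℕ} {Pb : BadPlacePredicates K} (D : InitialThetaData F K Fbar E l Pb)
  (hA : D.geom.pe.ArrowCoveringClaims) (CG : D.geom.pe.CuspGalois) (hTFG : D.geom.extF.GeomTFG)

namespace InitialThetaData

/-! ### `Ker((m2StandIn).aug) = Ker(augLoc).map standInEquiv` and the transport of `hΔ` -/

section StandIn

variable (x : D.IndexCopy) (hx : x ∉ D.indexCopyArc)

/-- Membership in `Ker(Π_v̲ ↠ Gal(K̄_v̲/K_v̲))` at the stand-in is membership of the `standInEquiv`-preimage in
`Ker(Π_{X̲→_K} ×_{G_K} Gal(K̄_v̲/K_v̲) ↠ Gal(K̄_v̲/K_v̲))`. ([IUTchI] Def 3.1 (e) p.62) [claim: Mochizuki2012, status: disputed] -/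
theorem mem_ker_m2StandIn_aug_iff [Fact (D.primeAt x hx).Prime] (g : ↥(D.badPairAtArrow hA x).H) :
    g ∈ (D.m2StandIn hA CG hTFG x hx).aug.ker ↔
      (D.standInEquiv hA CG hTFG x hx).symm g ∈ (D.augLoc D.PiXarrow (D.rhoAt x hx)).ker := Iff.rfl

/-- **`Δ_v̲` at the stand-in IS the transport of `Δ` of `Π_{X̲→_K} ×_{G_K} Gal(K̄_v̲/K_v̲)`**:
`Ker((m2StandIn).aug) = Ker(augLoc).map standInEquiv`. ([IUTchI] Def 3.1 (e) p.62) [claim: Mochizuki2012, status: disputed] -/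
theorem ker_m2StandIn_aug_eq_map [Fact (D.primeAt x hx).Prime] :
    (D.m2StandIn hA CG hTFG x hx).aug.ker =
      (D.augLoc D.PiXarrow (D.rhoAt x hx)).ker.map (D.standInEquiv hA CG hTFG x hx).toMulEquiv.toMonoidHom := by
  ext g
  rw [mem_ker_m2StandIn_aug_iff, Subgroup.mem_map]
  constructor
  · intro hg
    exact ⟨(D.standInEquiv hA CG hTFG x hx).symm g, hg, (D.standInEquiv hA CG hTFG x hx).apply_symm_apply g⟩
  · rintro ⟨y, hy, rfl⟩
    change (D.standInEquiv hA CG hTFG x hx).symm (D.standInEquiv hA CG hTFG x hx y) ∈ _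
    rwa [(D.standInEquiv hA CG hTFG x hx).symm_apply_apply]

/-- **Transport of `hΔ`**: if every bicontinuous automorphism of `Π_{X̲→_K} ×_{G_K} Gal(K̄_v̲/K_v̲)` preserves `Ker(augLoc)`, then every
bicontinuous automorphism of the stand-in `Π_v̲` preserves `Ker((m2StandIn).aug)`. ([IUTchI] Ex 3.2 (vi) (a) p.73) [claim: Mochizuki2012, status: disputed] -/
theorem forall_map_ker_m2StandIn_aug_of_forall_map_ker_augLoc [Fact (D.primeAt x hx).Prime]
    (hloc : ∀ ψ : D.PiLoc D.PiXarrow (D.rhoAt x hx) ≃ₜ* D.PiLoc D.PiXarrow (D.rhoAt x hx),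
      (D.augLoc D.PiXarrow (D.rhoAt x hx)).ker.map ψ.toMulEquiv.toMonoidHom = (D.augLoc D.PiXarrow (D.rhoAt x hx)).ker)
    (φ : ↥(D.badPairAtArrow hA x).H ≃ₜ* ↥(D.badPairAtArrow hA x).H) :
    (D.m2StandIn hA CG hTFG x hx).aug.ker.map φ.toMulEquiv.toMonoidHom = (D.m2StandIn hA CG hTFG x hx).aug.ker := by
  rw [D.ker_m2StandIn_aug_eq_map hA CG hTFG x hx]
  exact subgroup_map_equiv_transport _ _ hloc φ

/-- **`hΔ` at the stand-in from [AbsAnab] Lemma 1.3.8 BY NAME** (FACT F-0007 `PreservesGeom`) on ANY packaging `Ev` of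
`Π_v̲ ↠ Gal(K̄_v̲/K_v̲)` as an abc-iut-L4 extension (`e : Π_{Ev} ≅ Π_v̲`, `e(Δ_{Ev}) = Ker((m2StandIn).aug)`): if every self-isomorphism of
`Π_{Ev}` satisfies `PreservesGeom`, every bicontinuous automorphism of `Π_v̲` preserves `Δ_v̲`. [cite: MochizukiAbsAnab2004, Lemma 1.3.8 p.18] -/
theorem forall_map_ker_m2StandIn_aug_of_preservesGeom [Fact (D.primeAt x hx).Prime] (Ev : FundamentalExtension.{0})
    (e : Ev.arith ≃ₜ* ↥(D.badPairAtArrow hA x).H)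
    (he : Ev.geom.map e.toMulEquiv.toMonoidHom = (D.m2StandIn hA CG hTFG x hx).aug.ker)
    (hgeom : ∀ α : Ev.arith ≃ₜ* Ev.arith, FundamentalExtension.PreservesGeom α)
    (φ : ↥(D.badPairAtArrow hA x).H ≃ₜ* ↥(D.badPairAtArrow hA x).H) :
    (D.m2StandIn hA CG hTFG x hx).aug.ker.map φ.toMulEquiv.toMonoidHom = (D.m2StandIn hA CG hTFG x hx).aug.ker := by
  rw [← he]
  exact subgroup_map_equiv_transport e Ev.geom hgeom φ

/-- **NON-VACUITY of the packaging at the stand-in, WITH MLF BASE DATA**: `Π_v̲ ↠ Gal(K̄_v̲/K_v̲)` IS an extension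
`1 → Δ → Π → G → 1` of profinite groups in abc-iut-L4's sense with `MLFBase` `K := K_v̲ = RescaledCompletion K p_v̲ w_v̲`
(`exists_fundamentalExtension_PiLoc` for `Π_{X̲→_K} ×_{G_K} Gal(K̄_v̲/K_v̲)`, composed with `standInEquiv`; `hX` from `hA` + F-0240 + `CG`),
and `Δ_{Ev}` is topologically finitely generated under F-0240 `GeomTFG`. [cite: MochizukiAbsAnab2004, §1.3 p.18] -/
theorem exists_fundamentalExtension_standIn [Fact (D.primeAt x hx).Prime] :
    ∃ (Ev : FundamentalExtension.{0}) (_ : Ev.MLFBase) (e : Ev.arith ≃ₜ* ↥(D.badPairAtArrow hA x).H),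
      Ev.geom.map e.toMulEquiv.toMonoidHom = (D.m2StandIn hA CG hTFG x hx).aug.ker ∧
        IsTopologicallyFinitelyGenerated Ev.geom := by
  haveI := D.isScalarTower
  haveI := D.normal_K
  letI : Algebra K (RescaledCompletion K (D.primeAt x hx) (D.specAt x hx) (D.primeAt_mem x hx)) :=
    inferInstanceAs (Algebra K ((D.specAt x hx).adicCompletion K))
  haveI := GaloisValDatum.finiteDimensional_rescaledCompletion K (D.primeAt x hx) (D.specAt x hx) (D.primeAt_mem x hx)
  have hX : IsOpen (D.PiXarrow : Set D.PiC) := D.isOpen_PiXarrow_of_cuspGalois hA hTFG CG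
  -- the packaging of `Π_{X̲→_K} ×_{G_K} Gal(K̄_v̲/K_v̲)` (abc-iut-L5-t16), re-spelled over `rhoAt` (definitional unfolding)
  have hex : ∃ (Ev : FundamentalExtension.{0}) (_ : Ev.MLFBase) (e : Ev.arith ≃ₜ* D.PiLoc D.PiXarrow (D.rhoAt x hx)),
      Ev.geom.map e.toMulEquiv.toMonoidHom = (D.augLoc D.PiXarrow (D.rhoAt x hx)).ker ∧
        (D.geom.extF.GeomTFG → IsTopologicallyFinitelyGenerated Ev.geom) :=
    D.exists_fundamentalExtension_PiLoc (D.primeAt x hx)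
      (RescaledCompletion K (D.primeAt x hx) (D.specAt x hx) (D.primeAt_mem x hx))
      (localEmb (K := K) (Fbar := Fbar)
        (AlgebraicClosure (RescaledCompletion K (D.primeAt x hx) (D.specAt x hx) (D.primeAt_mem x hx)))) hX
  obtain ⟨Ev, B, e₀, he₀, htfg⟩ := hex
  refine ⟨Ev, B, e₀.trans (D.standInEquiv hA CG hTFG x hx), ?_, htfg hTFG⟩
  rw [D.ker_m2StandIn_aug_eq_map hA CG hTFG x hx, ← he₀, Subgroup.map_map]
  rfl

/-- **`hΔ` at the stand-in from [AbsTopI] Thm 2.6 (v) in the regime `CoinvariantRankConstant` (FACT F-0001) BY NAME on packagings**: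
if every packaging of `Π_v̲ ↠ Gal(K̄_v̲/K_v̲)` with MLF base data and `e(Δ_{Ev}) = Δ_v̲` has `CoinvariantRankConstant`, then — `Δ_C` being
tfg (F-0240, the record's `hTFG`) — every bicontinuous automorphism of `Π_v̲` preserves `Δ_v̲` (packaging by
`exists_fundamentalExtension_standIn`, kernel theorem `preservesGeom_of_coinvariantRankConstant`). [cite: MochizukiAbsTopI2012, Thm 2.6 (v) p.22] -/
theorem forall_map_ker_m2StandIn_aug_of_regime [Fact (D.primeAt x hx).Prime]
    (hreg : ∀ (Ev : FundamentalExtension.{0}) (_ : Ev.MLFBase) (e : Ev.arith ≃ₜ* ↥(D.badPairAtArrow hA x).H),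
      Ev.geom.map e.toMulEquiv.toMonoidHom = (D.m2StandIn hA CG hTFG x hx).aug.ker → Ev.CoinvariantRankConstant)
    (φ : ↥(D.badPairAtArrow hA x).H ≃ₜ* ↥(D.badPairAtArrow hA x).H) :
    (D.m2StandIn hA CG hTFG x hx).aug.ker.map φ.toMulEquiv.toMonoidHom = (D.m2StandIn hA CG hTFG x hx).aug.ker := by
  obtain ⟨Ev, B, e, he, htfg⟩ := D.exists_fundamentalExtension_standIn hA CG hTFG x hx
  exact D.forall_map_ker_m2StandIn_aug_of_preservesGeom hA CG hTFG x hx Ev e he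
    (fun α => FundamentalExtension.preservesGeom_of_coinvariantRankConstant B B htfg (hreg Ev B e he) htfg
      (hreg Ev B e he) α) φ

/-- **`hΔ` at the stand-in DERIVED — F-0007 at `Π_v̲` from F-0240 + F-0001 IN UNFOLDED SHAPE at `Π_{X̲→_K} ×_{G_K} Gal(K̄_v̲/K_v̲)`.**
If `Δ_C` is topologically finitely generated (F-0240 `GeomTFG`, the record's `hTFG`) and for every open subgroup
`P ⊆ Π_{X̲→_K} ×_{G_K} Gal(K̄_v̲/K_v̲)` the number `δ¹_l(P) − δ¹_l(aug P)` does not depend on the prime `l` (F-0001 `CoinvariantRankConstant`;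
print: [AbsTopI] Thm 2.6 (ii) on open subgroups — the `rfl`-same binder type as [IUTchI] Ex. 3.3 (iii)(a)'s at `(p_v̲, w_v̲)`), then every
bicontinuous automorphism of the stand-in `Π_v̲` carries `Δ_v̲ = Ker(Π_v̲ ↠ Gal(K̄_v̲/K_v̲))` onto itself; `hX` is FREE here
(`isOpen_PiXarrow_of_cuspGalois hA hTFG CG`). [cite: MochizukiAbsTopI2012, Thm 2.6 (v) p.22] -/
theorem forall_map_ker_m2StandIn_aug_of_coinvariantRank [Fact (D.primeAt x hx).Prime]
    (hc : ∀ P : Subgroup (D.PiLoc D.PiXarrow (D.rhoAt x hx)), IsOpen (P : Set (D.PiLoc D.PiXarrow (D.rhoAt x hx))) →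
      ∀ (l₁ l₂ : ℕ) [Fact l₁.Prime] [Fact l₂.Prime],
        freeProlRank P l₁ - freeProlRank (P.map (D.augLoc D.PiXarrow (D.rhoAt x hx))) l₁ =
          freeProlRank P l₂ - freeProlRank (P.map (D.augLoc D.PiXarrow (D.rhoAt x hx))) l₂)
    (φ : ↥(D.badPairAtArrow hA x).H ≃ₜ* ↥(D.badPairAtArrow hA x).H) :
    (D.m2StandIn hA CG hTFG x hx).aug.ker.map φ.toMulEquiv.toMonoidHom = (D.m2StandIn hA CG hTFG x hx).aug.ker := by
  haveI := D.isScalarTower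
  haveI := D.normal_K
  letI : Algebra K (RescaledCompletion K (D.primeAt x hx) (D.specAt x hx) (D.primeAt_mem x hx)) :=
    inferInstanceAs (Algebra K ((D.specAt x hx).adicCompletion K))
  haveI := GaloisValDatum.finiteDimensional_rescaledCompletion K (D.primeAt x hx) (D.specAt x hx) (D.primeAt_mem x hx)
  have hX : IsOpen (D.PiXarrow : Set D.PiC) := D.isOpen_PiXarrow_of_cuspGalois hA hTFG CG
  refine D.forall_map_ker_m2StandIn_aug_of_forall_map_ker_augLoc hA CG hTFG x hx (fun ψ => ?_) φ
  exact D.forall_map_ker_augLoc_of_coinvariantRank (D.primeAt x hx)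
    (RescaledCompletion K (D.primeAt x hx) (D.specAt x hx) (D.primeAt_mem x hx))
    (localEmb (K := K) (Fbar := Fbar)
      (AlgebraicClosure (RescaledCompletion K (D.primeAt x hx) (D.specAt x hx) (D.primeAt_mem x hx)))) hTFG hX hc ψ

end StandIn

/-! ### [IUTchI] Example 3.2 (vi)(a)(b)(c) at the stand-in merge record — `hH`, `hY`, `hΔ` all gone -/

section Cone

variable (x : D.IndexCopy) (hx : x ∈ D.indexCopyBad)

/-- **[IUTchI] Ex. 3.2 (vi)(a)(b)(c) AT THE STAND-IN MERGE RECORD, `hΔ` DERIVED — modulo F-0240 (the record's `hTFG`) and F-0001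
`CoinvariantRankConstant` IN UNFOLDED SHAPE at `Π_{X̲→_K} ×_{G_K} Gal(K̄_v̲/K_v̲)` ONLY**: at
`frobeniusBadAt (badPairAtArrow hA) (mergeInputsStandIn …) x hx`, (a) `𝒟⊢ ⊆ 𝒟` from `𝒟`, (b) `𝒟^Θ` from `𝒟`, (c) bases from `𝒞⊢`/`𝒞^Θ` —
★ p501395 `ex32vi_abc_frobeniusBadAt_standIn` with its binder `hΔ` := `forall_map_ker_m2StandIn_aug_of_coinvariantRank`; the currency of
[IUTchI] Ex. 3.3 (iii)(a) of record (`ddashFromD_goodLocalFrobenioidAt_of_coinvariantRank`). ([IUTchI] Ex 3.2 (vi) p.73) [claim: Mochizuki2012, status: disputed] -/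
theorem ex32vi_abc_frobeniusBadAt_standIn_of_coinvariantRank [Fact (D.primeAt x (D.not_mem_arc_of_mem_bad hx)).Prime]
    (hc : ∀ P : Subgroup (D.PiLoc D.PiXarrow (D.rhoAt x (D.not_mem_arc_of_mem_bad hx))),
      IsOpen (P : Set (D.PiLoc D.PiXarrow (D.rhoAt x (D.not_mem_arc_of_mem_bad hx)))) →
      ∀ (l₁ l₂ : ℕ) [Fact l₁.Prime] [Fact l₂.Prime],
        freeProlRank P l₁ - freeProlRank (P.map (D.augLoc D.PiXarrow (D.rhoAt x (D.not_mem_arc_of_mem_bad hx)))) l₁ =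
          freeProlRank P l₂ - freeProlRank (P.map (D.augLoc D.PiXarrow (D.rhoAt x (D.not_mem_arc_of_mem_bad hx)))) l₂) :
    (D.frobeniusBadAt _ (D.mergeInputsStandIn hA CG hTFG) x hx).DdashFromD ∧
      (D.frobeniusBadAt _ (D.mergeInputsStandIn hA CG hTFG) x hx).DThetaFromD ∧
      (D.frobeniusBadAt _ (D.mergeInputsStandIn hA CG hTFG) x hx).BasesFromC :=
  D.ex32vi_abc_frobeniusBadAt_standIn hA CG hTFG x hx
    (D.forall_map_ker_m2StandIn_aug_of_coinvariantRank hA CG hTFG x (D.not_mem_arc_of_mem_bad hx) hc)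

/-- **[IUTchI] Ex. 3.2 (vi)(a)(b)(c) at the stand-in merge record modulo F-0240 and F-0001 `CoinvariantRankConstant` BY NAME on every
packaging of `Π_v̲ ↠ Gal(K̄_v̲/K_v̲)` with MLF base data** (packagings exist: `exists_fundamentalExtension_standIn`).
([IUTchI] Ex 3.2 (vi) p.73) [claim: Mochizuki2012, status: disputed] -/
theorem ex32vi_abc_frobeniusBadAt_standIn_of_regime [Fact (D.primeAt x (D.not_mem_arc_of_mem_bad hx)).Prime]
    (hreg : ∀ (Ev : FundamentalExtension.{0}) (_ : Ev.MLFBase) (e : Ev.arith ≃ₜ* ↥(D.badPairAtArrow hA x).H),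
      Ev.geom.map e.toMulEquiv.toMonoidHom =
          (D.m2StandIn hA CG hTFG x (D.not_mem_arc_of_mem_bad hx)).aug.ker → Ev.CoinvariantRankConstant) :
    (D.frobeniusBadAt _ (D.mergeInputsStandIn hA CG hTFG) x hx).DdashFromD ∧
      (D.frobeniusBadAt _ (D.mergeInputsStandIn hA CG hTFG) x hx).DThetaFromD ∧
      (D.frobeniusBadAt _ (D.mergeInputsStandIn hA CG hTFG) x hx).BasesFromC :=
  D.ex32vi_abc_frobeniusBadAt_standIn hA CG hTFG x hx
    (D.forall_map_ker_m2StandIn_aug_of_regime hA CG hTFG x (D.not_mem_arc_of_mem_bad hx) hreg)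

/-- **[IUTchI] Ex. 3.2 (vi)(a)(b)(c) at the stand-in merge record modulo [AbsAnab] Lemma 1.3.8 BY NAME** (F-0007 `PreservesGeom` for every
self-isomorphism of ONE packaging `Ev` of `Π_v̲ ↠ Gal(K̄_v̲/K_v̲)`, `e(Δ_{Ev}) = Δ_v̲`) — the admissible «AT NAMED INSTANCE» form of F-0007.
([IUTchI] Ex 3.2 (vi) p.73) [claim: Mochizuki2012, status: disputed] -/
theorem ex32vi_abc_frobeniusBadAt_standIn_of_preservesGeom [Fact (D.primeAt x (D.not_mem_arc_of_mem_bad hx)).Prime]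
    (Ev : FundamentalExtension.{0}) (e : Ev.arith ≃ₜ* ↥(D.badPairAtArrow hA x).H)
    (he : Ev.geom.map e.toMulEquiv.toMonoidHom = (D.m2StandIn hA CG hTFG x (D.not_mem_arc_of_mem_bad hx)).aug.ker)
    (hgeom : ∀ α : Ev.arith ≃ₜ* Ev.arith, FundamentalExtension.PreservesGeom α) :
    (D.frobeniusBadAt _ (D.mergeInputsStandIn hA CG hTFG) x hx).DdashFromD ∧
      (D.frobeniusBadAt _ (D.mergeInputsStandIn hA CG hTFG) x hx).DThetaFromD ∧
      (D.frobeniusBadAt _ (D.mergeInputsStandIn hA CG hTFG) x hx).BasesFromC :=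
  D.ex32vi_abc_frobeniusBadAt_standIn hA CG hTFG x hx
    (D.forall_map_ker_m2StandIn_aug_of_preservesGeom hA CG hTFG x (D.not_mem_arc_of_mem_bad hx) Ev e he hgeom)

end Cone

end InitialThetaData

end Literature.IUT.HodgeTheaters

end
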